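import Summits.KontsevichZagierPeriods.KontsevichZagierPeriods.Theorems.LinRedNormalFormArrangementNormalFormStubRebaseSimplePosManyMoves

/-!
# Stub `stub_rebaseSimplePosMany`, part `rebaseSimplePosMany_product` (crux `ArrangementNormalForm`, line `janus-bands`) — `Wedge`

The analytic heart of the rebase of PRODUCT fibres over a base of dimension `B + 1`: ABSOLUTE
CONVERGENCE of the literal integrand on a Janus WEDGE of one fibre `i` in the presence of
spectator fibres, UNIFORMLY in the silent base coordinates `x'` (`RebaseMany.integrableOn_wedge`).
Over a base of dimension `≥ 2` the constant lower bound on the distance to the letter used over a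
one-dimensional base (`RebaseZero.integrableOn_wedge`) has no analogue; it is replaced by
fibrewise affine DOMINATION (`RebasePos.integrableOn_of_le_comp_pullInv`): the single-fibre
affine substitution `Ψ : tᵢ ↦ λ tᵢ + β(x', y)` (`RebasePos.pullInv` with trivial data off `i`)
maps the wedge `W = {P < tᵢ < Q}` into the domain `D = {Uᵢ < tᵢ < Vᵢ}` (same base cell, same
spectators) and the letter factor satisfies `|1/(tᵢ − c)| ≤ C |1/(Ψ tᵢ − c)|` on `W`; both
conditions are affine in `tᵢ` and are required at the two endpoints `P`, `Q` only, pointwise on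
the base cell. The two Janus extensions of the fibre `i` (`RebaseMany.janus_up`,
`RebaseMany.janus_down`, instances of `RebasePos.janusExtendHi/Lo`) and their dominated versions
(`janus_up_dom`: up to a level `κ ≥ Vᵢ` with `λ (κ − Vᵢ) ≤ Vᵢ − Uᵢ`; `janus_down_dom`: down to
a level `c ≤ κ ≤ Uᵢ` in the near regime `Vᵢ − c ≤ C (κ − c)`, `λ (Uᵢ − κ) ≤ Vᵢ − Uᵢ`).
Registered: `rebaseSimplePosMany_wedge`.

References: M. Kontsevich, D. Zagier, *Periods* (2001), §1.2, rules (1), (2).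
-/

noncomputable section

open Set MeasureTheory MvPolynomial
open Literature.NumberTheory.Transcendental Literature.ModelTheory.ExponentialFields

namespace Summit.KontsevichZagierPeriods.ArrangementNormalForm.JanusBands

namespace RebaseMany

open SeparatePos RebasePos

variable {B K : ℕ}

/-! ### The literal integrand and one fibre -/

/-- The literal integrand only sees the base coordinates and the lettered fibres. [folklore] -/
theorem glit_congr (T : BData B) (p : MvPolynomial (Fin B) ℚ) (a : Fin K → Option (Cf B))
    {z z' : Fin (B + 1 + K) → ℝ} (hb : ∀ j', z' (Fin.castAdd K j') = z (Fin.castAdd K j'))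
    (hf : ∀ j, a j ≠ none → z' (Fin.natAdd (B + 1) j) = z (Fin.natAdd (B + 1) j)) :
    glitB T p a z' = glitB T p a z := by
  simp only [glitB, glit, hb]
  congr 1
  refine Finset.prod_congr rfl fun j _ => ?_
  rcases ha : a j with _ | c
  · rfl
  · simp only [Option.elim_some, hf j (by simp [ha])]

/-- Splitting off the letter of the fibre `i`: `glit a = glit a[i ↦ none] · 1/(tᵢ − c)`. [folklore] -/
theorem glit_split (T : BData B) (p : MvPolynomial (Fin B) ℚ) (a : Fin K → Option (Cf B)) (i : Fin K)
    (c : Cf B) (ha : a i = some c) (z : Fin (B + 1 + K) → ℝ) :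
    glitB T p a z = glitB T p (Function.update a i none) z *
      (1 / (z (Fin.natAdd (B + 1) i) - affF B K c z)) := by
  have key : fib B K a z = fib B K (Function.update a i none) z *
      (1 / (z (Fin.natAdd (B + 1) i) - affF B K c z)) := by
    set g : Fin K → Option (Cf B) → ℝ := fun j o => o.elim (1 : ℝ) (fun c => 1 / (z (Fin.natAdd (B + 1) j) -
      (∑ i', (c.1 i' : ℝ) * z (Fin.castAdd K i') + (c.2 : ℝ)))) with hg
    have h1 : fib B K a z = ∏ j, g j (a j) := rfl
    have h2 : fib B K (Function.update a i none) z = ∏ j, g j (Function.update a i none j) := rfl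
    rw [h1, h2, ← Finset.mul_prod_erase Finset.univ (fun j => g j (a j)) (Finset.mem_univ i),
      ← Finset.mul_prod_erase Finset.univ (fun j => g j (Function.update a i none j)) (Finset.mem_univ i)]
    have h3 : ∏ j ∈ Finset.univ.erase i, g j (Function.update a i none j) =
        ∏ j ∈ Finset.univ.erase i, g j (a j) :=
      Finset.prod_congr rfl fun j hj => by rw [Function.update_of_ne (Finset.ne_of_mem_erase hj)]
    rw [h3, ha, Function.update_self]
    simp only [hg, Option.elim_some, Option.elim_none, one_mul, sum_eq_affF]
    exact mul_comm _ _
  simp only [glitB, glit_eq] at key ⊢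
  rw [key]
  ring

/-- Scaling the numerator scales the literal integrand. [folklore] -/
theorem glit_C_mul (T : BData B) (q : ℚ) (p : MvPolynomial (Fin B) ℚ) (a : Fin K → Option (Cf B))
    (z : Fin (B + 1 + K) → ℝ) : glitB T (MvPolynomial.C q * p) a z = q * glitB T p a z := by
  simp only [glitB, glit_eq, map_mul, MvPolynomial.aeval_C, eq_ratCast]
  ring

/-- The literal integrand without the letter of `i` is unchanged by the single-fibre substitution.
[folklore] -/
theorem glit_none_pullInv (T : BData B) (p : MvPolynomial (Fin B) ℚ) (a : Fin K → Option (Cf B))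
    (i : Fin K) (μ α : ℚ) (δ : (Fin B → ℚ) × ℚ) (w : Fin (B + 1 + K) → ℝ) :
    glitB T p (Function.update a i none) (pullInv (pullMu i μ) (pullAl i α) (pullDe i δ) w) =
      glitB T p (Function.update a i none) w :=
  glit_congr T p _ (fun j' => pullInv_base _ _ _ w j') fun j hj =>
    pullInv_single_of_ne i μ α δ w fun hji => hj (by subst hji; simp)

/-! ### The wedge -/

/-- **Absolute convergence on a wedge, uniformly in the silent coordinates.** Let the product
representation `s` (domain `D = {… Uᵢ < tᵢ < Vᵢ …}`) carry the letter `c` on the fibre `i`, and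
let `W = {… P < tᵢ < Q …}` (same base cell, same spectators). Suppose that for a rational
`λ > 0`, an atom `β` and a constant `C`, at every point of the base cell: `c ≤ P`,
`c ≤ λ P + β`, `Uᵢ ≤ λ P + β`, `λ Q + β ≤ Vᵢ` (the substitution `tᵢ ↦ λ tᵢ + β` maps `W` into
`D`, above the letter) and `λ P + β − c ≤ C (P − c)`, `λ Q + β − c ≤ C (Q − c)` (its letter
factor dominates). Then the literal integrand converges absolutely on `W`. -/
theorem integrableOn_wedge {s : KZ.IntegralRep (B + 1 + K)} {m' : ℕ} {M : Fin m' → Cf B}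
    {U V : Fin K → Cf B} {T : BData B} {p : MvPolynomial (Fin B) ℚ} {a : Fin K → Option (Cf B)}
    (h : IsProd s M U V T p a) (i : Fin K) (c : Cf B) (ha : a i = some c) (P Q β : Cf B) (lam : ℚ)
    (C : ℝ) (hlam : 0 < lam)
    (hg : ∀ z ∈ cell K M, affF B K c z ≤ affF B K P z ∧
      affF B K c z ≤ lam * affF B K P z + affF B K β z ∧
      affF B K (U i) z ≤ lam * affF B K P z + affF B K β z ∧
      lam * affF B K Q z + affF B K β z ≤ affF B K (V i) z ∧
      lam * affF B K P z + affF B K β z - affF B K c z ≤ C * (affF B K P z - affF B K c z) ∧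
      lam * affF B K Q z + affF B K β z - affF B K c z ≤ C * (affF B K Q z - affF B K c z)) :
    IntegrableOn (glitB T p a) (pDom M (Function.update U i P) (Function.update V i Q)) := by
  set W := pDom M (Function.update U i P) (Function.update V i Q) with hWdef
  set μv := pullMu i lam with hμv
  set αv := pullAl i (β.1 (Fin.last B)) with hαv
  set δv := pullDe i (restr B β) with hδv
  have hlam' : (0 : ℝ) < lam := by exact_mod_cast hlam
  have hΨi : ∀ w, pullInv μv αv δv w (Fin.natAdd (B + 1) i) =
      (lam : ℝ) * w (Fin.natAdd (B + 1) i) + affF B K β w := fun w => by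
    rw [hμv, hαv, hδv, pullInv_single_self', glue_restr]
  have hΨj : ∀ w (j : Fin K), j ≠ i → pullInv μv αv δv w (Fin.natAdd (B + 1) j) = w (Fin.natAdd (B + 1) j) :=
    fun w j hj => pullInv_single_of_ne i _ _ _ w hj
  have hmemW : ∀ w, w ∈ W ↔ w ∈ cell K M ∧ (affF B K P w < w (Fin.natAdd (B + 1) i) ∧
      w (Fin.natAdd (B + 1) i) < affF B K Q w) ∧ ∀ j, j ≠ i →
      affF B K (U j) w < w (Fin.natAdd (B + 1) j) ∧ w (Fin.natAdd (B + 1) j) < affF B K (V j) w := by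
    intro w
    rw [hWdef, mem_pDom_fibre M _ _ i]
    simp only [Function.update_self]
    refine and_congr_right fun _ => and_congr_right fun _ => ?_
    refine forall_congr' fun j => forall_congr' fun hj => ?_
    rw [Function.update_of_ne hj, Function.update_of_ne hj]
  -- `Ψ` maps the wedge into the domain
  have hmaps : MapsTo (pullInv μv αv δv) W s.domain := by
    intro w hw
    obtain ⟨hcell, ⟨h1, h2⟩, hrest⟩ := (hmemW w).1 hw
    obtain ⟨-, -, hU, hV, -, -⟩ := hg w hcell
    rw [h.dom, mem_pDom_fibre M U V i]
    refine ⟨(mem_cell_congr M fun j => pullInv_base _ _ _ w j).2 hcell, ?_, fun j hj => ?_⟩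
    · rw [affF_pullInv, affF_pullInv, hΨi]
      constructor <;> nlinarith
    · rw [affF_pullInv, affF_pullInv, hΨj w j hj]
      exact hrest j hj
  have hfD : IntegrableOn (glitB T p a) s.domain :=
    s.integrableOn.congr_fun h.int (KZ.IntegralRep.measurableSet_domain_holds s)
  refine integrableOn_of_le_comp_pullInv μv αv δv (pullMu_ne_zero i hlam.ne') (isSemialgebraic_pDom _ _ _)
    (isSemialgebraicFunOn_glit (isSemialgebraic_pDom _ _ _) _ _ _ _ _ _ _ _) hfD hmaps C
    fun w hw => ?_
  obtain ⟨hcell, ⟨h1, h2⟩, -⟩ := (hmemW w).1 hw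
  obtain ⟨hcP, hcβ, -, -, hCP, hCQ⟩ := hg w hcell
  rw [glit_split T p a i c ha, glit_split T p a i c ha, glit_none_pullInv, affF_pullInv, hΨi]
  set F := glitB T p (Function.update a i none) w with hF
  set t := w (Fin.natAdd (B + 1) i) with ht
  have hpos : 0 < t - affF B K c w := by linarith
  have hpos' : 0 < (lam : ℝ) * t + affF B K β w - affF B K c w := by nlinarith
  -- the domination, affine in `t`, from the two endpoints
  have hkey : (lam : ℝ) * t + affF B K β w - affF B K c w ≤ C * (t - affF B K c w) := by
    by_cases hC : (lam : ℝ) ≤ C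
    · have hm : ((lam : ℝ) - C) * (t - affF B K P w) ≤ 0 :=
        mul_nonpos_of_nonpos_of_nonneg (by linarith) (by linarith)
      nlinarith
    · have hm : ((lam : ℝ) - C) * (t - affF B K Q w) ≤ 0 :=
        mul_nonpos_of_nonneg_of_nonpos (by linarith) (by linarith)
      nlinarith
  have hCpos : 0 < C := by
    by_contra hC0
    push Not at hC0
    nlinarith
  rw [abs_mul, abs_mul, abs_of_pos (one_div_pos.2 hpos), abs_of_pos (one_div_pos.2 hpos'), mul_left_comm]
  refine mul_le_mul_of_nonneg_left ?_ (abs_nonneg F)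
  rw [mul_one_div, div_le_div_iff₀ hpos hpos', one_mul]
  exact hkey

/-! ### The Janus extensions of one fibre -/

/-- **Janus extension upwards** of the fibre `i` of a product representation: `D = {Uᵢ < tᵢ < Vᵢ}`
with `Uᵢ ≤ Vᵢ ≤ κ` on the base cell extends to `T = {Uᵢ < tᵢ < κ}` by the wedge
`W = {Vᵢ < tᵢ < κ}`, provided the literal integrand converges absolutely on `W`: both are product
representations and `[T] − [D] − [W] ∈ KZ.relations`. -/
theorem janus_up {s : KZ.IntegralRep (B + 1 + K)} {m' : ℕ} {M : Fin m' → Cf B} {U V : Fin K → Cf B}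
    {T : BData B} {p : MvPolynomial (Fin B) ℚ} {a : Fin K → Option (Cf B)} (h : IsProd s M U V T p a)
    (i : Fin K) (κ : Cf B)
    (hle : ∀ z ∈ cell K M, affF B K (U i) z ≤ affF B K (V i) z ∧ affF B K (V i) z ≤ affF B K κ z)
    (hW : IntegrableOn (glitB T p a) (pDom M (Function.update U i (V i)) (Function.update V i κ))) :
    ∃ sT sW : KZ.IntegralRep (B + 1 + K), IsProd sT M U (Function.update V i κ) T p a ∧
      IsProd sW M (Function.update U i (V i)) (Function.update V i κ) T p a ∧
      KZ.of sT - KZ.of s - KZ.of sW ∈ KZ.relations := by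
  obtain ⟨R, hR⟩ := h.cbd
  obtain ⟨sT, sW, hTd, hTi, -, hWd, hWi, -, hrel⟩ := janusExtendHi s M (fun j => Sum.inr (U j))
    (fun j => Sum.inr (V j)) h.dom T.L T.e p T.ℓ₁ T.ℓ₂ T.n₁ T.n₂ a h.int i (V i) κ rfl
    (fun z hz => (hle z hz).2)
    (fun z hz => by
      rw [update_inr, update_inr] at hz
      exact (hle z ((mem_pDom _ _ _ z).1 hz).1).1)
    (by rw [update_inr, update_inr]; exact hW)
    (by rw [update_inr]; exact isBounded_pDom _ _ _ hR)
  rw [update_inr] at hTd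
  rw [update_inr, update_inr] at hWd
  exact ⟨sT, sW, ⟨hTd, fun z _ => by rw [hTi]; rfl, h.adm, R, hR⟩,
    ⟨hWd, fun z _ => by rw [hWi]; rfl, h.adm, R, hR⟩, hrel⟩

/-- **Janus extension downwards** of the fibre `i`: `D = {Uᵢ < tᵢ < Vᵢ}` with `κ ≤ Uᵢ ≤ Vᵢ` on
the base cell extends to `T = {κ < tᵢ < Vᵢ}` by the wedge `W = {κ < tᵢ < Uᵢ}`, provided the
literal integrand converges absolutely on `W`. -/
theorem janus_down {s : KZ.IntegralRep (B + 1 + K)} {m' : ℕ} {M : Fin m' → Cf B} {U V : Fin K → Cf B}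
    {T : BData B} {p : MvPolynomial (Fin B) ℚ} {a : Fin K → Option (Cf B)} (h : IsProd s M U V T p a)
    (i : Fin K) (κ : Cf B)
    (hle : ∀ z ∈ cell K M, affF B K κ z ≤ affF B K (U i) z ∧ affF B K (U i) z ≤ affF B K (V i) z)
    (hW : IntegrableOn (glitB T p a) (pDom M (Function.update U i κ) (Function.update V i (U i)))) :
    ∃ sT sW : KZ.IntegralRep (B + 1 + K), IsProd sT M (Function.update U i κ) V T p a ∧
      IsProd sW M (Function.update U i κ) (Function.update V i (U i)) T p a ∧
      KZ.of sT - KZ.of s - KZ.of sW ∈ KZ.relations := by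
  obtain ⟨R, hR⟩ := h.cbd
  obtain ⟨sT, sW, hTd, hTi, -, hWd, hWi, -, hrel⟩ := janusExtendLo s M (fun j => Sum.inr (U j))
    (fun j => Sum.inr (V j)) h.dom T.L T.e p T.ℓ₁ T.ℓ₂ T.n₁ T.n₂ a h.int i (U i) κ rfl
    (fun z hz => (hle z hz).1)
    (fun z hz => by
      rw [update_inr, update_inr] at hz
      exact (hle z ((mem_pDom _ _ _ z).1 hz).1).2)
    (by rw [update_inr, update_inr]; exact hW)
    (by rw [update_inr]; exact isBounded_pDom _ _ _ hR)
  rw [update_inr] at hTd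
  rw [update_inr, update_inr] at hWd
  exact ⟨sT, sW, ⟨hTd, fun z _ => by rw [hTi]; rfl, h.adm, R, hR⟩,
    ⟨hWd, fun z _ => by rw [hWi]; rfl, h.adm, R, hR⟩, hrel⟩

/-- **Dominated Janus extension upwards**: a fibre above its letter (`c ≤ Uᵢ ≤ Vᵢ ≤ κ`) whose
upper wedge `{Vᵢ < tᵢ < κ}` is at most `λ⁻¹` times as long as the fibre (`λ (κ − Vᵢ) ≤ Vᵢ − Uᵢ`):
the wedge converges (substitution `tᵢ ↦ Vᵢ − λ (κ − tᵢ)`, constant `1`). -/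
theorem janus_up_dom {s : KZ.IntegralRep (B + 1 + K)} {m' : ℕ} {M : Fin m' → Cf B} {U V : Fin K → Cf B}
    {T : BData B} {p : MvPolynomial (Fin B) ℚ} {a : Fin K → Option (Cf B)} (h : IsProd s M U V T p a)
    (i : Fin K) (c : Cf B) (ha : a i = some c) (κ : Cf B) (lam : ℚ) (hlam : 0 < lam)
    (hle : ∀ z ∈ cell K M, affF B K c z ≤ affF B K (U i) z ∧ affF B K (U i) z ≤ affF B K (V i) z ∧
      affF B K (V i) z ≤ affF B K κ z ∧
      lam * (affF B K κ z - affF B K (V i) z) ≤ affF B K (V i) z - affF B K (U i) z) :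
    ∃ sT sW : KZ.IntegralRep (B + 1 + K), IsProd sT M U (Function.update V i κ) T p a ∧
      IsProd sW M (Function.update U i (V i)) (Function.update V i κ) T p a ∧
      KZ.of sT - KZ.of s - KZ.of sW ∈ KZ.relations := by
  have hlam' : (0 : ℝ) < lam := by exact_mod_cast hlam
  refine janus_up h i κ (fun z hz => ⟨(hle z hz).2.1, (hle z hz).2.2.1⟩)
    (integrableOn_wedge h i c ha (V i) κ (V i - lam • κ) lam 1 hlam fun z hz => ?_)
  obtain ⟨hcU, hUV, hVκ, hlen⟩ := hle z hz
  rw [affF_sub, affF_smul]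
  refine ⟨by linarith, by nlinarith, by nlinarith, by nlinarith, by nlinarith, by nlinarith⟩

/-- **Dominated Janus extension downwards (near regime)**: a fibre above a level `κ` above its
letter (`c ≤ κ ≤ Uᵢ ≤ Vᵢ`) with `λ (Uᵢ − κ) ≤ Vᵢ − Uᵢ` and `Vᵢ − c ≤ C (κ − c)` on the base cell:
the lower wedge `{κ < tᵢ < Uᵢ}` converges (substitution `tᵢ ↦ Uᵢ + λ (tᵢ − κ)`, constant `C`). -/
theorem janus_down_dom {s : KZ.IntegralRep (B + 1 + K)} {m' : ℕ} {M : Fin m' → Cf B} {U V : Fin K → Cf B}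
    {T : BData B} {p : MvPolynomial (Fin B) ℚ} {a : Fin K → Option (Cf B)} (h : IsProd s M U V T p a)
    (i : Fin K) (c : Cf B) (ha : a i = some c) (κ : Cf B) (lam : ℚ) (C : ℝ) (hlam : 0 < lam)
    (hle : ∀ z ∈ cell K M, affF B K c z ≤ affF B K κ z ∧ affF B K κ z ≤ affF B K (U i) z ∧
      affF B K (U i) z ≤ affF B K (V i) z ∧
      lam * (affF B K (U i) z - affF B K κ z) ≤ affF B K (V i) z - affF B K (U i) z ∧
      affF B K (V i) z - affF B K c z ≤ C * (affF B K κ z - affF B K c z)) :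
    ∃ sT sW : KZ.IntegralRep (B + 1 + K), IsProd sT M (Function.update U i κ) V T p a ∧
      IsProd sW M (Function.update U i κ) (Function.update V i (U i)) T p a ∧
      KZ.of sT - KZ.of s - KZ.of sW ∈ KZ.relations := by
  have hlam' : (0 : ℝ) < lam := by exact_mod_cast hlam
  refine janus_down h i κ (fun z hz => ⟨(hle z hz).2.1, (hle z hz).2.2.1⟩)
    (integrableOn_wedge h i c ha κ (U i) (U i - lam • κ) lam C hlam fun z hz => ?_)
  obtain ⟨hcκ, hκU, hUV, hlen, hC⟩ := hle z hz
  rw [affF_sub, affF_smul]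
  have hκc : 0 ≤ affF B K κ z - affF B K c z := by linarith
  have hC1 : affF B K (U i) z - affF B K c z ≤ C * (affF B K κ z - affF B K c z) := by linarith
  refine ⟨hcκ, by nlinarith, by nlinarith, by nlinarith, by nlinarith, ?_⟩
  -- at `Q = Uᵢ`: `Uᵢ − c + λ (Uᵢ − κ) ≤ Vᵢ − c ≤ C (κ − c) ≤ C (Uᵢ − c)`
  rcases hκc.eq_or_lt with h0 | hpos
  · have hV0 : affF B K (V i) z - affF B K c z ≤ 0 := by rw [← h0, mul_zero] at hC; exact hC
    have hUc : affF B K (U i) z = affF B K c z := by linarith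
    have hκc' : affF B K κ z = affF B K c z := by linarith
    have heq : (lam : ℝ) * affF B K (U i) z + (affF B K (U i) z - lam * affF B K κ z) - affF B K c z =
        C * (affF B K (U i) z - affF B K c z) := by
      rw [hUc, hκc']; ring
    exact heq.le
  · have hCpos : 0 ≤ C := by
      by_contra hC0
      push Not at hC0
      nlinarith
    nlinarith

end RebaseMany

/-- Registered support goal of this file: absolute convergence of the literal integrand on a
Janus wedge of one fibre of a product representation over a base of dimension `B + 1`, uniformly
in the silent base coordinates (`RebaseMany.integrableOn_wedge`). -/
theorem rebaseSimplePosMany_wedge (B K m' : ℕ) (s : KZ.IntegralRep (B + 1 + K)) (M : Fin m' → (Fin (B + 1) → ℚ) × ℚ) (U V : Fin K → (Fin (B + 1) → ℚ) × ℚ) (T : RebaseMany.BData B) (p : MvPolynomial (Fin B) ℚ) (a : Fin K → Option ((Fin (B + 1) → ℚ) × ℚ)) (h : RebaseMany.IsProd s M U V T p a) (i : Fin K) (c : (Fin (B + 1) → ℚ) × ℚ) (ha : a i = some c) (P Q β : (Fin (B + 1) → ℚ) × ℚ) (lam : ℚ) (C : ℝ) (hlam : 0 < lam) (hg : ∀ z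 ∈ RebaseMany.cell K M, SeparatePos.affF B K c z ≤ SeparatePos.affF B K P z ∧ SeparatePos.affF B K c z ≤ lam * SeparatePos.affF B K P z + SeparatePos.affF B K β z ∧ SeparatePos.affF B K (U i) z ≤ lam * SeparatePos.affF B K P z + SeparatePos.affF B K β z ∧ lam * SeparatePos.affF B K Q z + SeparatePos.affF B K β z ≤ SeparatePos.affF B K (V i) z ∧ lam * SeparatePos.affF B K P z + SeparatePos.affF B K β z - SeparatePos.affF B K c z ≤ C * (SeparatePos.affF B K P z - SeparatePos.affF B K c z) ∧ lam * SeparatePos.affF B K Q z + SeparatePos.affF B K β z - SeparatePos.affF B K c z ≤ C * (SeparatePos.affF B K Q z - SeparatePos.affF B K c z)) : IntegrableOn (RebaseMany.glitB T p a) (RebaseMany.pDom M (Function.update U i P) (Function.update V i Q)) :=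
  RebaseMany.integrableOn_wedge h i c ha P Q β lam C hlam hg

end Summit.KontsevichZagierPeriods.ArrangementNormalForm.JanusBands
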